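import Summits.HodgeConjecture.HodgeConjecture.Theorems.F0P3cStCharTSCartanFin       -- (B7b) p851733 (this seat): `exists_finset_cartanSubgroups` (N1★)
import Summits.HodgeConjecture.HodgeConjecture.Theorems.F0P3cStCharTSCartanEllProd   -- ★ p851715 (F0P2-p01 (g22)): `exists_cartanEll_of_finite_classes` (compact, irredundant NORMAL FORM)
import Summits.HodgeConjecture.HodgeConjecture.Theorems.F0P3cStCharTSCartanReps      -- ★ p851537 (this lineage, g23): `exists_isRegularElt_centralizer_eq_cmTorus` (brings ★ EllCartanCompact, CartanFields)
import HarnessLib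

/-!
# F0 · P3c · line LH6 «StCharTS» — «CARTAN-ALL★»: a SET OF REPRESENTATIVES of the conjugacy classes of Cartan subgroups of `U(Φ₃)(L⁺_v)` with the split torus `M` singled out
# (the `cartanAll` of the §12.5 datum, [Rogawski1990, §12.5 p. 182; §3.6 pp. 28–29])

Cell `pub/hodgecm-mathlib`, crux H413 = `stmt-HodgeConjecture-24833` (lane `--supports … --as helper`), route HCCMUnconditional; seat F0P3a-p03 (g24) (road owner CARTAN-FIN (N1); census-first TAKING
«CARTAN-ALL★» 14:48Z).  THEOREMS ONLY; ★-only imports + Mathlib.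

WHAT.  `G = Gqs L v = U(Φ₃)(L⁺_v)`, `v` non-split; `M = (cmBorelTriple L 3 v).M` the split torus.  **`exists_cartanAll`**: a finite set `cartanAll` of subgroups with (1) `M ∈ cartanAll`; (2) every
member is the centraliser of a regular element; (3) every member other than `M` is compact; (4) COMPLETENESS — the centraliser of every regular `γ` is `u T u⁻¹` for some `T ∈ cartanAll`;
(5) IRREDUNDANCY — two conjugate members are equal.  PROOF = composition of ★ names: `SA` := ★ `exists_cartanEll_of_finite_classes (exists_finset_cartanSubgroups L v hns)` (compact
representatives, complete for compact Cartan subgroups, pairwise non-conjugate; F0P2-p01 over N1★), `cartanAll := insert M SA`; `M = Z(m₀)`, `m₀` regular (★ `exists_isRegularElt_centralizer_eq_cmTorus`);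
a non-compact `Z(γ)` is `x M x⁻¹` (★ `exists_conj_cmTorus_of_not_isCompact_centralizer`); `M` is non-compact (★ `not_isCompact_cmTorus`) and compactness is conjugation-invariant (★
`isCompact_map_conj_iff`), so `M` is conjugate to no member of `SA`.  This is `𝔇.cartanAll` ∕ `cartanG := SA` for RUNG0 v2 — irredundant, so that the Weyl integration formula at the constructed datum is
print's statement verbatim.  HONEST LABEL: HC_CM is proved only modulo the 7 printed citations (2 remaining named inputs hLiu418 = `stmt-HodgeConjecture-24832`, h413 = `stmt-HodgeConjecture-24833`)
until rung 0 closes; count-neutral constructor-side asset.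

## References
* [Rogawski1990] J. D. Rogawski, *Automorphic Representations of Unitary Groups in Three Variables*, Ann. of Math. Stud. 123 (1990), §3.6 pp. 28–29 (Cartan subgroups of `U(3)`: type (0) =
  the split torus, the others compact), §12.5 p. 182 («a set of representatives for the conjugacy classes of Cartan subgroups»).
* [PlatonovRapinchuk1994] V. Platonov, A. Rapinchuk, *Algebraic Groups and Number Theory* (1994), §6.4 Cor. 1.
-/

set_option autoImplicit false
-- the mandated namespace has the single-problem summit's repeated segment (`HodgeConjecture.HodgeConjecture`)
set_option linter.dupNamespace false

noncomputable section

open NumberField IsDedekindDomain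
open scoped Matrix MatrixGroups
open Literature.NumberTheory.Rogawski1990 Literature.NumberTheory.Automorphic Literature.NumberTheory.Automorphic.UnitaryGroup
open Literature.NumberTheory.GaloisRepresentations Literature.GroupTheory
open Summit.HodgeConjecture.HodgeConjecture.Cruxes.H413.F0P3cStCharTSCartanFin (exists_finset_cartanSubgroups)
open Summit.HodgeConjecture.HodgeConjecture.Cruxes.H413.F0P3cStCharTSCartanEllProd (exists_cartanEll_of_finite_classes)
open Summit.HodgeConjecture.HodgeConjecture.Cruxes.H413.F0P3cStCharTSCartanReps (exists_isRegularElt_centralizer_eq_cmTorus)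
open Summit.HodgeConjecture.HodgeConjecture.Cruxes.H413.F0P3cStCharTSEllCartanCompact (exists_conj_cmTorus_of_not_isCompact_centralizer)
open Summit.HodgeConjecture.HodgeConjecture.Cruxes.H413.F0P3cStCharTSCartanFields (not_isCompact_cmTorus)

namespace Summit.HodgeConjecture.HodgeConjecture.Cruxes.H413.F0P3cStCharTSCartanAll

variable (L : Type) [Field L] [NumberField L] [IsCMField L] (v : HeightOneSpectrum (𝓞 ↥(maximalRealSubfield L)))

/-- **«CARTAN-ALL★» — a set of representatives of the conjugacy classes of Cartan subgroups of `U(Φ₃)(L⁺_v)` containing the split torus `M`** (`v` non-split): `M ∈ cartanAll`,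
every member is `Z(γ₀)` with `γ₀` regular, every member `≠ M` is compact, every Cartan subgroup is conjugate to a member, and conjugate members are equal.
[cite: Rogawski1990, §12.5 p. 182; §3.6 pp. 28–29] [cite: PlatonovRapinchuk1994, §6.4 Cor. 1] -/
theorem exists_cartanAll (hns : ∀ w : PlacesOver L v, IsCMField.complexConj L • w.1 = w.1) :
    ∃ cartanAll : Finset (Subgroup (Gqs L v)),
      (cmBorelTriple L 3 v).M ∈ cartanAll ∧
      (∀ T ∈ cartanAll, ∃ γ₀ : Gqs L v, IsRegularElt (γ₀.val : GL (Fin 3) (LocalRing L v)) ∧ T = Subgroup.centralizer ({γ₀} : Set (Gqs L v))) ∧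
      (∀ T ∈ cartanAll, T ≠ (cmBorelTriple L 3 v).M → IsCompact (T : Set (Gqs L v))) ∧
      (∀ γ : Gqs L v, IsRegularElt (γ.val : GL (Fin 3) (LocalRing L v)) →
        ∃ T ∈ cartanAll, ∃ u : Gqs L v, Subgroup.centralizer ({γ} : Set (Gqs L v)) = T.map (MulAut.conj u).toMonoidHom) ∧
      (∀ T ∈ cartanAll, ∀ T' ∈ cartanAll, (∃ x : Gqs L v, T.map (MulAut.conj x).toMonoidHom = T') → T = T') := by
  classical
  obtain ⟨SA, hSA, hcov, hdist⟩ := exists_cartanEll_of_finite_classes (A := Gqs L v)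
    (P := fun γ : Gqs L v => IsRegularElt (γ.val : GL (Fin 3) (LocalRing L v))) (exists_finset_cartanSubgroups L v hns)
  obtain ⟨m₀, -, hm₀reg, hZm₀⟩ := exists_isRegularElt_centralizer_eq_cmTorus L v hns
  -- the split torus is NOT compact (the carrier of `Gqs L v` is the subgroup type, definitionally)
  have hMnc := not_isCompact_cmTorus L v
  refine ⟨insert (cmBorelTriple L 3 v).M SA, Finset.mem_insert_self _ _, ?_, ?_, ?_, ?_⟩
  · intro T hT
    rcases Finset.mem_insert.1 hT with rfl | hT'
    · exact ⟨m₀, hm₀reg, hZm₀.symm⟩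
    · exact (hSA T hT').2
  · intro T hT hTM
    rcases Finset.mem_insert.1 hT with rfl | hT'
    · exact absurd rfl hTM
    · exact (hSA T hT').1
  · intro γ hreg
    by_cases hc : IsCompact ((Subgroup.centralizer ({γ} : Set (Gqs L v))) : Set (Gqs L v))
    · obtain ⟨T, hT, x, hx⟩ := hcov γ hreg hc
      refine ⟨T, Finset.mem_insert_of_mem hT, x⁻¹, ?_⟩
      -- `Z(xγx⁻¹) = T` ⇒ `Z(γ) = x⁻¹ T x`
      rw [← hx, ← centralizer_singleton_conj_eq_map]
      congr 2
      group
    · obtain ⟨x, m, -, hxm, hZ⟩ := exists_conj_cmTorus_of_not_isCompact_centralizer L v hns hreg hc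
      refine ⟨(cmBorelTriple L 3 v).M, Finset.mem_insert_self _ _, x, ?_⟩
      ext g
      rw [Subgroup.mem_map_equiv, MulAut.conj_symm_apply]
      exact hZ g
  · intro T hT T' hT' hconj
    rcases Finset.mem_insert.1 hT with rfl | hTS <;> rcases Finset.mem_insert.1 hT' with rfl | hT'S
    · rfl
    · -- `M` conjugate to a compact member: impossible
      obtain ⟨x, hx⟩ := hconj
      exact absurd ((isCompact_map_conj_iff _ x).1 (hx ▸ (hSA T' hT'S).1)) hMnc
    · obtain ⟨x, hx⟩ := hconj
      have hTc : IsCompact (T : Set (Gqs L v)) := (hSA T hTS).1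
      exact absurd ((isCompact_map_conj_iff T x).2 hTc) (hx ▸ hMnc)
    · exact hdist T hTS T' hT'S hconj

/-- **«CARTAN-ALL★» in the letters of the Weyl-integration cover** (★ `F0P3cStCharTSWeylCartanCover.lintegral_setOf_isRegularElt_eq_sum_cartanSet`'s `hS`∕`hcov`∕`hnc`, F0P3a-p05 (g22)):
the same family, with conjugacy written as `∀ g, g ∈ Z(γ) ↔ x⁻¹ g x ∈ T` and irredundancy as `T ≠ T' → ∀ y, ¬ (∀ h, h ∈ T' ↔ y⁻¹ h y ∈ T)`.
[cite: Rogawski1990, §12.5 p. 182; §3.6 pp. 28–29] -/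
theorem exists_cartanAll_weylShape (hns : ∀ w : PlacesOver L v, IsCMField.complexConj L • w.1 = w.1) :
    ∃ cartanAll : Finset (Subgroup (Gqs L v)),
      (cmBorelTriple L 3 v).M ∈ cartanAll ∧
      (∀ T ∈ cartanAll, ∃ γ₀ : Gqs L v, IsRegularElt (γ₀.val : GL (Fin 3) (LocalRing L v)) ∧ T = Subgroup.centralizer ({γ₀} : Set (Gqs L v))) ∧
      (∀ T ∈ cartanAll, T ≠ (cmBorelTriple L 3 v).M → IsCompact (T : Set (Gqs L v))) ∧
      (∀ γ : Gqs L v, IsRegularElt (γ.val : GL (Fin 3) (LocalRing L v)) →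
        ∃ T ∈ cartanAll, ∃ x : Gqs L v, ∀ g : Gqs L v, g ∈ Subgroup.centralizer ({γ} : Set (Gqs L v)) ↔ x⁻¹ * g * x ∈ T) ∧
      (∀ T ∈ cartanAll, ∀ T' ∈ cartanAll, T ≠ T' → ∀ y : Gqs L v, ¬ ∀ h : Gqs L v, h ∈ T' ↔ y⁻¹ * h * y ∈ T) := by
  obtain ⟨C, hM, hZ, hcpt, hcov, hirr⟩ := exists_cartanAll L v hns
  refine ⟨C, hM, hZ, hcpt, fun γ hreg => ?_, fun T hT T' hT' hne y hy => hne (hirr T hT T' hT' ⟨y, ?_⟩)⟩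
  · obtain ⟨T, hT, u, hu⟩ := hcov γ hreg
    refine ⟨T, hT, u, fun g => ?_⟩
    rw [hu, Subgroup.mem_map_equiv, MulAut.conj_symm_apply]
  · ext h
    rw [Subgroup.mem_map_equiv, MulAut.conj_symm_apply]
    exact (hy h).symm

end Summit.HodgeConjecture.HodgeConjecture.Cruxes.H413.F0P3cStCharTSCartanAll

end
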